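import Literature.Geometry.Kaehler.ComplexTorusAnalyticSlices
import Literature.Geometry.Kaehler.AnalyticSetAdaptedSections
import Literature.Geometry.Kaehler.HolomorphicChainSheetCoarea
import Literature.Geometry.Kaehler.AnalyticSetIntersectionDimension
import HarnessLib

/-!
# The fibre formula for the analytic cycle class of a product torus

Layer `Literature/Geometry/Kaehler`, namespace `Literature.Geometry.Kaehler[.ComplexTorus]`; lane
`lit-hodgefound`, seat p07, programme «THE ANALYTIC CLASSES OF A COMPLEX TORUS FORM A RING», file 6
(files 1–5: `ComplexTorusAnalyticClassesCupProductReduction.lean`, `HolomorphicChainSheetCoarea.lean`,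
`AnalyticSetSlices.lean`, `AnalyticSetAdaptedSections.lean`, `ComplexTorusAnalyticSlices.lean`).

**Theorem (`ComplexTorus.analyticCyclePeriod_cross_eq_integral_fibreSlice`).** Let
`X = X₁ × X₂ = (E₁ ⊞ E₂)/(Λ₁ ⊕ Λ₂)` be the Euclidean product torus (`prodPeriodL2 Φ₁ Φ₂`), `Z ⊆ X`
analytic of pure dimension `q + dim E₂` with `0 < q`, `γ` an invariant `2q`-form of `X₁` and `ν` an
invariant form of `X₂` of top degree `2 dim E₂`. Then
`∫_Z pr₁^*γ ∧ pr₂^*ν = ν(e₂, ie₂, …) · ∫_{t ∈ Φ₂([0,1)^ι₂)} (∫_{Z_t} γ) d𝓗^{2 dim E₂}(t)`,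
where `Z_t = {x̄ ∈ X₁ | (x̄, π₂ t) ∈ Z}` is the slice, for a.e. `t` empty (contributing `0`) or of pure
dimension `q` (`ComplexTorus.ae_hasPureDim_fibreSlice`), and `∫_{Z_t} γ = analyticCyclePeriod Φ₁ _ γ`.

This is the coarea formula [Federer1969, 3.2.22] for the projection `pr₂` restricted to the regular
locus of `π⁻¹Z`, organised as follows (§2): the carrier `reg π⁻¹Z ∩ box` splits into the part critical
for `pr₂`, on which the integrand vanishes identically
(`HolomorphicChain.cross_apply_orientationFrame_eq_zero_of_critical`), and countably many disjoint
measurable pieces of holomorphic sheets ADAPTED to `pr₂` (§1, `exists_adapted_section_of_finrank_eq`: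
sections of `(x, y) ↦ (ℓ₁ x, y)`), on each of which the local coarea formula
`HolomorphicChain.integral_image_section_cross_eq` of file 2 applies; summing (`integral_iUnion`,
`integral_tsum`, the `L¹` bound coming from `HolomorphicChain.lintegral_image_section_cross_eq_enorm`)
gives `ν(e₂,…) ∫_t Σₙ Fₙ(t) dt`, and for a.e. `t` — those over which no regular point is critical, the
slice of the singular locus is `𝓗^{2q}`-null and the slice is pure `q`-dimensional
(`ae_hasPureDim_fibreSlice`) — the fibre terms `Fₙ(t)` are identified with the integrals of `γ(ξ_{[Z_t]})`
over the slices of the pieces by the sheet formula `HolomorphicChain.integral_image_section_eq` on the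
slice chain (non-critical regular points slice to regular points, `isRegPt_slice_of_nonCritical`), whose
union is `reg π₁⁻¹Z_t ∩ box₁` up to a `𝓗^{2q}`-null set; the period of `[Z_t]` is that integral
(`analyticCyclePeriod_eq_setIntegral`).

Theorems only; no definitions, no named facts.

## References

* [Federer1969] H. Federer, *Geometric Measure Theory*, Springer 1969, 3.2.22 (coarea formula), 3.2.5.
* [Chirka1989] E. M. Chirka, *Complex Analytic Sets*, Kluwer 1989, §2.3, A2.2, §14.1 Cor. p. 174.
* [VoisinHodgeI2002] C. Voisin, *Hodge Theory and Complex Algebraic Geometry I*, CUP 2002, §11.1.2.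
-/

noncomputable section

open scoped Manifold Topology ENNReal
open MeasureTheory MeasureTheory.Measure Set Function Filter Module TopologicalSpace WithLp
open Literature.Geometry.GeometricMeasureTheory Literature.Analysis.Complex

universe u

namespace Literature.Geometry.Kaehler

/-! ### §1 Adapted sections with a prescribed parameter space -/

section AdaptedK

variable {E₁ : Type u} [NormedAddCommGroup E₁] [NormedSpace ℂ E₁] [FiniteDimensional ℂ E₁]
  {E₂ : Type u} [NormedAddCommGroup E₂] [NormedSpace ℂ E₂] [FiniteDimensional ℂ E₂]
  {K : Type*} [NormedAddCommGroup K] [NormedSpace ℂ K] [FiniteDimensional ℂ K]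

/-- **Sheets adapted to the second projection, with a prescribed `q`-dimensional parameter space `K`**
(the variant of `exists_adapted_section` with `ℂ^q` replaced by any complex normed space `K` of
dimension `q = dim E₁ - c`): at a non-critical regular point `z₀` of `A ⊆ E₁ ⊞ E₂` there are a
complex-linear `ℓ₁ : E₁ → K`, `ℓ(x, y) = (ℓ₁ x, y)`, an open `W ⊆ K ⊞ E₂`, a holomorphic section `s` of
`ℓ` over `W` and an open `N ∋ z₀` with `s(W) = A ∩ N` and `dg` onto along `N`.
[cite: Chirka1989, A2.2 (implicit function theorem), p. 305; §2.3, p. 29] -/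
theorem exists_adapted_section_of_finrank_eq {A U : Set (WithLp 2 (E₁ × E₂))} {z₀ : WithLp 2 (E₁ × E₂)}
    {c : ℕ} {g : WithLp 2 (E₁ × E₂) → (Fin c → ℂ)} (hU : IsOpen U) (hz₀U : z₀ ∈ U) (hz₀A : z₀ ∈ A)
    (hg : DifferentiableOn ℂ g U) (hAU : A ∩ U = U ∩ g ⁻¹' {0}) (hsurj : Surjective (fderiv ℂ g z₀))
    (hnc : ∀ v : E₂, ∃ u : WithLp 2 (E₁ × E₂), fderiv ℂ g z₀ u = 0 ∧ (ofLp u).2 = v)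
    {q : ℕ} (hq : finrank ℂ E₁ = q + c) (hK : finrank ℂ K = q) :
    ∃ (ℓ₁ : E₁ →L[ℂ] K) (ℓ : WithLp 2 (E₁ × E₂) →L[ℂ] WithLp 2 (K × E₂)) (W : Set (WithLp 2 (K × E₂)))
      (s : WithLp 2 (K × E₂) → WithLp 2 (E₁ × E₂)) (N : Set (WithLp 2 (E₁ × E₂))),
      (∀ z, ℓ z = toLp 2 (ℓ₁ (ofLp z).1, (ofLp z).2)) ∧ IsOpen W ∧ IsOpen N ∧ z₀ ∈ N ∧ N ⊆ U ∧
      DifferentiableOn ℂ s W ∧ (∀ w ∈ W, ℓ (s w) = w) ∧ s '' W = A ∩ N ∧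
      ∀ z ∈ N, Surjective (fderiv ℂ g z) := by
  have hn : finrank ℂ (WithLp 2 (E₁ × E₂)) = finrank ℂ E₁ + finrank ℂ E₂ := by
    rw [(WithLp.linearEquiv 2 ℂ (E₁ × E₂)).finrank_eq, Module.finrank_prod]
  set T : Submodule ℂ (WithLp 2 (E₁ × E₂)) :=
    LinearMap.ker (fderiv ℂ g z₀ : WithLp 2 (E₁ × E₂) →ₗ[ℂ] (Fin c → ℂ)) with hT
  have hTdim : finrank ℂ T = q + finrank ℂ E₂ := by
    have h := LinearMap.finrank_range_add_finrank_ker (fderiv ℂ g z₀ : WithLp 2 (E₁ × E₂) →ₗ[ℂ] (Fin c → ℂ))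
    rw [LinearMap.range_eq_top.2 hsurj, finrank_top, Module.finrank_fin_fun, hn, hq] at h
    rw [hT]
    omega
  have hT2 : ∀ v : E₂, ∃ u ∈ T, (ofLp u).2 = v := fun v ↦ by
    obtain ⟨u, hu0, hu⟩ := hnc v
    exact ⟨u, LinearMap.mem_ker.2 hu0, hu⟩
  obtain ⟨ℓ₀, hℓ₀⟩ := exists_clm_forall_eq_zero_of_forall_exists hT2 hTdim
  -- transport `ℂ^q ≅ K`
  have hKq : finrank ℂ (EuclideanSpace ℂ (Fin q)) = finrank ℂ K := by rw [finrank_euclideanSpace_fin, hK]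
  set φ : EuclideanSpace ℂ (Fin q) ≃L[ℂ] K := ContinuousLinearEquiv.ofFinrankEq hKq with hφ
  set ℓ₁ : E₁ →L[ℂ] K := (φ : EuclideanSpace ℂ (Fin q) →L[ℂ] K).comp ℓ₀ with hℓ₁def
  have hℓ₁ : ∀ u ∈ T, ℓ₁ (ofLp u).1 = 0 → (ofLp u).2 = 0 → u = 0 := fun u hu h1 h2 ↦
    hℓ₀ u hu (by simpa [hℓ₁def] using h1) h2
  set ℓ : WithLp 2 (E₁ × E₂) →L[ℂ] WithLp 2 (K × E₂) :=
    (((WithLp.prodContinuousLinearEquiv 2 ℂ K E₂).symm : K × E₂ →L[ℂ] WithLp 2 (K × E₂)).comp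
      ((ℓ₁.prodMap (ContinuousLinearMap.id ℂ E₂)).comp
        (WithLp.prodContinuousLinearEquiv 2 ℂ E₁ E₂ : WithLp 2 (E₁ × E₂) →L[ℂ] E₁ × E₂))) with hℓdef
  have hℓ : ∀ z, ℓ z = toLp 2 (ℓ₁ (ofLp z).1, (ofLp z).2) := fun z ↦ rfl
  have hinj : Injective ((fderiv ℂ g z₀).prod ℓ) := by
    refine (injective_iff_map_eq_zero ((fderiv ℂ g z₀).prod ℓ)).2 fun u hu ↦ ?_
    rw [ContinuousLinearMap.prod_apply, Prod.mk_eq_zero] at hu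
    have hℓu : toLp 2 (ℓ₁ (ofLp u).1, (ofLp u).2) = (0 : WithLp 2 (K × E₂)) := by
      rw [← hℓ]; exact hu.2
    have h12 : (ℓ₁ (ofLp u).1, (ofLp u).2) = (0 : K × E₂) := by
      simpa using congrArg ofLp hℓu
    exact hℓ₁ u (LinearMap.mem_ker.2 hu.1) (congrArg Prod.fst h12) (congrArg Prod.snd h12)
  have hdimeq : finrank ℂ (WithLp 2 (E₁ × E₂)) = finrank ℂ ((Fin c → ℂ) × WithLp 2 (K × E₂)) := by
    rw [Module.finrank_prod, Module.finrank_fin_fun, (WithLp.linearEquiv 2 ℂ (K × E₂)).finrank_eq,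
      Module.finrank_prod, hK, hn, hq]
    ring
  have hbij : Bijective ((fderiv ℂ g z₀).prod ℓ) :=
    ⟨hinj, (LinearMap.injective_iff_surjective_of_finrank_eq_finrank hdimeq).1 hinj⟩
  obtain ⟨W, s, N, hW, hN, hz₀N, hNU, hs, hℓs, himg, hsurjN⟩ :=
    SCV.exists_section_of_bijective hU hz₀U hz₀A hg hAU ℓ hbij
  exact ⟨ℓ₁, ℓ, W, s, N, hℓ, hW, hN, hz₀N, hNU, hs, hℓs, himg, hsurjN⟩

end AdaptedK

namespace ComplexTorus

/-! ### §2 The fibre formula -/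

section Fibre

variable {ι₁ ι₂ : Type*} [Fintype ι₁] [Fintype ι₂]
  {E₁ : Type u} [NormedAddCommGroup E₁] [InnerProductSpace ℂ E₁] [FiniteDimensional ℂ E₁]
  [MeasurableSpace E₁] [BorelSpace E₁]
  {E₂ : Type u} [NormedAddCommGroup E₂] [InnerProductSpace ℂ E₂] [FiniteDimensional ℂ E₂]
  [MeasurableSpace E₂] [BorelSpace E₂]
  (Φ₁ : (ι₁ → ℝ) ≃L[ℝ] E₁) (Φ₂ : (ι₂ → ℝ) ≃L[ℝ] E₂)

open Classical in
/-- **The fibre formula (coarea over the second factor) for the analytic cycle class of a product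
torus.** Let `Z ⊆ X₁ × X₂` be analytic of pure dimension `q + dim E₂` with `0 < q`, `γ` an invariant
`2q`-form of `X₁` and `ν` an invariant form of `X₂` of top degree `2 dim E₂`. Then
`∫_Z pr₁^*γ ∧ pr₂^*ν = ν(e₂, ie₂, …) · ∫_{t ∈ Φ₂([0,1)^ι₂)} (∫_{Z_t} γ) d𝓗^{2 dim E₂}(t)`,
where `Z_t = {x̄ | (x̄, π₂ t) ∈ Z}` is the slice (for a.e. `t` empty — contributing `0` — or of pure
dimension `q`, `ae_hasPureDim_fibreSlice`). Proof: the carrier `reg π⁻¹Z` splits into the critical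
part, on which the integrand vanishes (`cross_apply_orientationFrame_eq_zero_of_critical`), and countably
many disjoint measurable pieces of sheets adapted to `pr₂` (`exists_adapted_section`), on each of which
the local coarea formula `HolomorphicChain.integral_image_section_cross_eq` applies; the fibre integrals
are then identified, for a.e. `t`, with the period of the slice by the sheet formula on the slice chain
(`HolomorphicChain.integral_image_section_eq`, `isRegPt_slice_of_nonCritical`) up to the `𝓗^{2q}`-null
slice of the singular locus. [cite: Federer1969, 3.2.22 (coarea formula); Chirka1989, §14.1 Cor., p. 174;
VoisinHodgeI2002, §11.1.2] -/
theorem analyticCyclePeriod_cross_eq_integral_fibreSlice {q : ℕ} (hq : 0 < q)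
    {Z : Set (ComplexTorus (prodPeriodL2 Φ₁ Φ₂))}
    (hZ : HasPureDim 𝓘(ℂ, WithLp 2 (E₁ × E₂)) Z (q + finrank ℂ E₂))
    (γ : E₁ [⋀^Fin (2 * q)]→L[ℝ] ℂ) (ν : E₂ [⋀^Fin (2 * finrank ℂ E₂)]→L[ℝ] ℂ)
    (h2 : 2 * q + 2 * finrank ℂ E₂ = 2 * (q + finrank ℂ E₂))
    (e₂ : OrthonormalBasis (Fin (finrank ℂ E₂)) ℂ E₂) :
    analyticCyclePeriod (prodPeriodL2 Φ₁ Φ₂) hZ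
        ((((γ.compContinuousLinearMap (ContinuousLinearMap.fst ℝ E₁ E₂)).wedge
            (ν.compContinuousLinearMap (ContinuousLinearMap.snd ℝ E₁ E₂))).domDomCongr
          (finCongr h2)).compContinuousLinearMap
          (WithLp.prodContinuousLinearEquiv 2 ℝ E₁ E₂ : WithLp 2 (E₁ × E₂) →L[ℝ] E₁ × E₂)) =
      ν (complexFrame ⇑e₂) * ∫ t in periodBox Φ₂ 0,
        (if h : HasPureDim 𝓘(ℂ, E₁)
            {x : ComplexTorus Φ₁ | (prodHomeomorphL2 Φ₁ Φ₂).symm (x, cover Φ₂ t) ∈ Z} q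
          then analyticCyclePeriod Φ₁ h γ else 0) ∂(μHE[2 * finrank ℂ E₂] : Measure E₂) := by
  classical
  -- ### Step 0: the period as a set integral (rewritten first, so that the abbreviations below fold it)
  rw [analyticCyclePeriod_eq_setIntegral]
  -- ### notation and basic facts
  set T := analyticChain (prodPeriodL2 Φ₁ Φ₂) hZ with hT
  set A : Set (WithLp 2 (E₁ × E₂)) := cover (prodPeriodL2 Φ₁ Φ₂) ⁻¹' Z with hA
  set C : Set (WithLp 2 (E₁ × E₂)) := T.carrier with hC
  set box : Set (WithLp 2 (E₁ × E₂)) := periodBox (prodPeriodL2 Φ₁ Φ₂) 0 with hbox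
  set Ω : (WithLp 2 (E₁ × E₂)) [⋀^Fin (2 * (q + (finrank ℂ E₂)))]→L[ℝ] ℂ :=
    ((((γ.compContinuousLinearMap (ContinuousLinearMap.fst ℝ E₁ E₂)).wedge
        (ν.compContinuousLinearMap (ContinuousLinearMap.snd ℝ E₁ E₂))).domDomCongr
      (finCongr h2)).compContinuousLinearMap
      (WithLp.prodContinuousLinearEquiv 2 ℝ E₁ E₂ : WithLp 2 (E₁ × E₂) →L[ℝ] E₁ × E₂)) with hΩ
  set F : E₂ → ℂ := fun t ↦
    if h : HasPureDim 𝓘(ℂ, E₁) {x : ComplexTorus Φ₁ | (prodHomeomorphL2 Φ₁ Φ₂).symm (x, cover Φ₂ t) ∈ Z} q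
    then analyticCyclePeriod Φ₁ h γ else 0 with hF
  letI : InnerProductSpace ℝ E₂ := InnerProductSpace.complexToReal
  haveI : FiniteDimensional ℝ E₂ := FiniteDimensional.complexToReal E₂
  letI : InnerProductSpace ℝ (EuclideanSpace ℂ (ULift.{u} (Fin q))) := InnerProductSpace.complexToReal
  haveI : FiniteDimensional ℝ (EuclideanSpace ℂ (ULift.{u} (Fin q))) :=
    FiniteDimensional.complexToReal (EuclideanSpace ℂ (ULift.{u} (Fin q)))
  have hK₀ : finrank ℂ (EuclideanSpace ℂ (ULift.{u} (Fin q))) = q := by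
    rw [finrank_euclideanSpace, Fintype.card_ulift, Fintype.card_fin]
  have hK2 : finrank ℝ (EuclideanSpace ℂ (ULift.{u} (Fin q))) = 2 * q := by rw [finrank_real_of_complex, hK₀]
  have hV22 : finrank ℝ E₂ = 2 * finrank ℂ E₂ := by rw [finrank_real_of_complex]
  haveI : SigmaFinite (μHE[2 * q] : Measure (EuclideanSpace ℂ (ULift.{u} (Fin q)))) := by
    rw [← hK2, InnerProductSpace.euclideanHausdorffMeasure_eq_volume]; infer_instance
  haveI : (μHE[2 * (finrank ℂ E₂)] : Measure E₂).IsAddHaarMeasure := by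
    rw [← hV22, InnerProductSpace.euclideanHausdorffMeasure_eq_volume]; infer_instance
  have hD : 0 < q + (finrank ℂ E₂) := by omega
  have hn : finrank ℂ (WithLp 2 (E₁ × E₂)) = finrank ℂ E₁ + (finrank ℂ E₂) := by
    rw [(WithLp.linearEquiv 2 ℂ (E₁ × E₂)).finrank_eq, Module.finrank_prod]
  obtain ⟨c₀, hc₀, hAc⟩ := hasPureDim_preimage_cover (prodPeriodL2 Φ₁ Φ₂) hZ
  have hn₁ : finrank ℂ E₁ = q + c₀ := by omega
  have hmemC : ∀ z, z ∈ C ↔ z ∈ A ∧ ∃ c, SCV.IsRegPt A c z := fun z ↦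
    mem_carrier_analyticChain_iff_isRegPt (prodPeriodL2 Φ₁ Φ₂) hZ
  have hCA : C ⊆ A := fun z hz ↦ ((hmemC z).1 hz).1
  have hCreg : ∀ z ∈ C, SCV.IsRegPt A c₀ z := fun z hz ↦ by
    have h := isRegPt_of_mem_carrier_analyticChain (prodPeriodL2 Φ₁ Φ₂) hZ hz
    rwa [show finrank ℂ (WithLp 2 (E₁ × E₂)) - (q + (finrank ℂ E₂)) = c₀ by omega] at h
  have hCeq : C = regularLocus 𝓘(ℂ, WithLp 2 (E₁ × E₂)) A := carrier_analyticChain_eq (prodPeriodL2 Φ₁ Φ₂) hZ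
  have hCm : MeasurableSet C := T.measurableSet_carrier
  have hboxm : MeasurableSet box := measurableSet_periodBox (prodPeriodL2 Φ₁ Φ₂) 0
  have hmembox : ∀ z : WithLp 2 (E₁ × E₂), z ∈ box ↔
      (ofLp z).1 ∈ periodBox Φ₁ 0 ∧ (ofLp z).2 ∈ periodBox Φ₂ 0 :=
    fun z ↦ mem_periodBox_prodPeriodL2_iff Φ₁ Φ₂ z
  have hint : IntegrableOn (fun z ↦ Ω (T.orientationFrame z)) (C ∩ box)
      (μHE[2 * (q + (finrank ℂ E₂))] : Measure (WithLp 2 (E₁ × E₂))) :=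
    integrableOn_apply_orientationFrame_carrier_inter_periodBox (prodPeriodL2 Φ₁ Φ₂) hZ Ω
  -- ### Step 1: adapted sheets through the non-critical regular points
  have hsheet : ∀ z ∈ C, (∃ (U : Set (WithLp 2 (E₁ × E₂))) (c : ℕ) (g : WithLp 2 (E₁ × E₂) → (Fin c → ℂ)),
      IsOpen U ∧ z ∈ U ∧ DifferentiableOn ℂ g U ∧ A ∩ U = U ∩ g ⁻¹' {0} ∧ Surjective (fderiv ℂ g z) ∧
      ∀ v : E₂, ∃ u : WithLp 2 (E₁ × E₂), fderiv ℂ g z u = 0 ∧ (ofLp u).2 = v) →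
      ∃ (ℓ₁ : E₁ →L[ℂ] EuclideanSpace ℂ (ULift.{u} (Fin q)))
        (ℓ : WithLp 2 (E₁ × E₂) →L[ℂ] WithLp 2 (EuclideanSpace ℂ (ULift.{u} (Fin q)) × E₂))
        (W : Set (WithLp 2 (EuclideanSpace ℂ (ULift.{u} (Fin q)) × E₂)))
        (s : WithLp 2 (EuclideanSpace ℂ (ULift.{u} (Fin q)) × E₂) → WithLp 2 (E₁ × E₂)) (N : Set (WithLp 2 (E₁ × E₂))),
        (∀ z, ℓ z = toLp 2 (ℓ₁ (ofLp z).1, (ofLp z).2)) ∧ IsOpen W ∧ IsOpen N ∧ DifferentiableOn ℂ s W ∧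
        (∀ w ∈ W, ℓ (s w) = w) ∧ s '' W = A ∩ N ∧ A ∩ N ⊆ C ∧ z ∈ N := by
    intro z hzC hzNC
    obtain ⟨U, c, g, hU, hzU, hg, hAU, hsurj, hnc⟩ := hzNC
    have hzA := hCA hzC
    have hcc : c = c₀ := SCV.IsRegPt.codim_unique hzA ⟨U, hU, hzU, g, hg, hAU, hsurj⟩ (hCreg z hzC)
    subst hcc
    obtain ⟨ℓ₁, ℓ, W, s, N, hℓ, hW, hN, hzN, hNU, hs, hℓs, himg, hsurjN⟩ :=
      exists_adapted_section_of_finrank_eq hU hzU hzA hg hAU hsurj hnc hn₁ hK₀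
    refine ⟨ℓ₁, ℓ, W, s, N, hℓ, hW, hN, hs, hℓs, himg, ?_, hzN⟩
    rintro z' ⟨hz'A, hz'N⟩
    exact (hmemC z').2 ⟨hz'A, c, U, hU, hNU hz'N, g, hg, hAU, hsurjN z' hz'N⟩
  -- ### Step 2: a countable family of sheets covering the non-critical part of the carrier
  set C₀ : Set (WithLp 2 (E₁ × E₂)) := {z ∈ C | ∃ (U : Set (WithLp 2 (E₁ × E₂))) (c : ℕ)
      (g : WithLp 2 (E₁ × E₂) → (Fin c → ℂ)),
      IsOpen U ∧ z ∈ U ∧ DifferentiableOn ℂ g U ∧ A ∩ U = U ∩ g ⁻¹' {0} ∧ Surjective (fderiv ℂ g z) ∧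
      ∀ v : E₂, ∃ u : WithLp 2 (E₁ × E₂), fderiv ℂ g z u = 0 ∧ (ofLp u).2 = v} with hC₀
  -- a "junk" adapted linear map for empty sheets
  set ℓ0 : WithLp 2 (E₁ × E₂) →L[ℂ] WithLp 2 (EuclideanSpace ℂ (ULift.{u} (Fin q)) × E₂) :=
    (((WithLp.prodContinuousLinearEquiv 2 ℂ (EuclideanSpace ℂ (ULift.{u} (Fin q))) E₂).symm :
        EuclideanSpace ℂ (ULift.{u} (Fin q)) × E₂ →L[ℂ] WithLp 2 (EuclideanSpace ℂ (ULift.{u} (Fin q)) × E₂)).comp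
      (((0 : E₁ →L[ℂ] EuclideanSpace ℂ (ULift.{u} (Fin q))).prodMap (ContinuousLinearMap.id ℂ E₂)).comp
        (WithLp.prodContinuousLinearEquiv 2 ℂ E₁ E₂ : WithLp 2 (E₁ × E₂) →L[ℂ] E₁ × E₂))) with hℓ0def
  have hℓ0 : ∀ z, ℓ0 z = toLp 2 ((0 : E₁ →L[ℂ] EuclideanSpace ℂ (ULift.{u} (Fin q))) (ofLp z).1, (ofLp z).2) :=
    fun z ↦ rfl
  obtain ⟨𝔩₁, 𝔩, 𝔚, 𝔰, 𝔑, hSP, hcov⟩ : ∃ (𝔩₁ : ℕ → (E₁ →L[ℂ] EuclideanSpace ℂ (ULift.{u} (Fin q))))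
      (𝔩 : ℕ → (WithLp 2 (E₁ × E₂) →L[ℂ] WithLp 2 (EuclideanSpace ℂ (ULift.{u} (Fin q)) × E₂)))
      (𝔚 : ℕ → Set (WithLp 2 (EuclideanSpace ℂ (ULift.{u} (Fin q)) × E₂)))
      (𝔰 : ℕ → WithLp 2 (EuclideanSpace ℂ (ULift.{u} (Fin q)) × E₂) → WithLp 2 (E₁ × E₂))
      (𝔑 : ℕ → Set (WithLp 2 (E₁ × E₂))),
      (∀ n, (∀ z, 𝔩 n z = toLp 2 (𝔩₁ n (ofLp z).1, (ofLp z).2)) ∧ IsOpen (𝔚 n) ∧ IsOpen (𝔑 n) ∧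
        DifferentiableOn ℂ (𝔰 n) (𝔚 n) ∧ (∀ w ∈ 𝔚 n, 𝔩 n (𝔰 n w) = w) ∧ 𝔰 n '' 𝔚 n = A ∩ 𝔑 n ∧
        A ∩ 𝔑 n ⊆ C) ∧ C₀ ⊆ ⋃ n, 𝔑 n := by
    choose! f₁ f f𝔚 f𝔰 f𝔑 hf using hsheet
    have hLind : ∃ 𝒯 ⊆ C₀, 𝒯.Countable ∧ C₀ ⊆ ⋃ z ∈ 𝒯, f𝔑 z := by
      apply TopologicalSpace.countable_cover_nhdsWithin
      intro z hz
      have h := hf z hz.1 hz.2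
      exact mem_nhdsWithin_of_mem_nhds (h.2.2.1.mem_nhds h.2.2.2.2.2.2.2)
    obtain ⟨𝒯, h𝒯C₀, h𝒯c, h𝒯cov⟩ := hLind
    rcases 𝒯.eq_empty_or_nonempty with h𝒯 | h𝒯
    · refine ⟨fun _ ↦ 0, fun _ ↦ ℓ0, fun _ ↦ ∅, fun _ _ ↦ 0, fun _ ↦ ∅, fun n ↦
        ⟨hℓ0, isOpen_empty, isOpen_empty, differentiableOn_empty, fun w hw ↦ hw.elim, by simp,
          by simp⟩, ?_⟩
      rw [h𝒯] at h𝒯cov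
      intro z hz
      simpa using h𝒯cov hz
    · obtain ⟨e, he⟩ := h𝒯c.exists_eq_range h𝒯
      have he' : ∀ n, e n ∈ C₀ := fun n ↦ h𝒯C₀ (he ▸ mem_range_self n)
      refine ⟨fun n ↦ f₁ (e n), fun n ↦ f (e n), fun n ↦ f𝔚 (e n), fun n ↦ f𝔰 (e n),
        fun n ↦ f𝔑 (e n), fun n ↦ ?_, ?_⟩
      · have h := hf (e n) (he' n).1 (he' n).2
        exact ⟨h.1, h.2.1, h.2.2.1, h.2.2.2.1, h.2.2.2.2.1, h.2.2.2.2.2.1, h.2.2.2.2.2.2.1⟩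
      · intro z hz
        obtain ⟨z', hz'𝒯, hzz'⟩ := mem_iUnion₂.1 (h𝒯cov hz)
        obtain ⟨n, rfl⟩ : z' ∈ range e := he ▸ hz'𝒯
        exact mem_iUnion.2 ⟨n, hzz'⟩
  -- derived sheet facts
  have hℓ₂ : ∀ n z, (ofLp (𝔩 n z)).2 = (ofLp z).2 := fun n z ↦ by rw [(hSP n).1 z]
  have hsW : ∀ n, 𝔰 n '' 𝔚 n ⊆ C := fun n ↦ (hSP n).2.2.2.2.2.1 ▸ (hSP n).2.2.2.2.2.2
  have hsWN : ∀ n, 𝔰 n '' 𝔚 n = C ∩ 𝔑 n := fun n ↦ by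
    apply Subset.antisymm
    · exact subset_inter (hsW n) ((hSP n).2.2.2.2.2.1 ▸ inter_subset_right)
    · rw [(hSP n).2.2.2.2.2.1]
      exact fun z hz ↦ ⟨hCA hz.1, hz.2⟩
  have hopen : ∀ n, ∀ w ∈ 𝔚 n, ∃ N ∈ 𝓝 (𝔰 n w), C ∩ N ⊆ 𝔰 n '' 𝔚 n := fun n w hw ↦
    ⟨𝔑 n, (hSP n).2.2.1.mem_nhds ((hsWN n ▸ mem_image_of_mem _ hw : 𝔰 n w ∈ C ∩ 𝔑 n).2),
      (hsWN n).symm ▸ Subset.rfl⟩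
  have hs2 : ∀ n, ∀ w ∈ 𝔚 n, (ofLp (𝔰 n w)).2 = (ofLp w).2 := fun n w hw ↦ by
    rw [← hℓ₂ n (𝔰 n w), (hSP n).2.2.2.2.1 w hw]
  -- ### Step 3: disjoint measurable pieces, and the critical remainder
  set B : ℕ → Set (WithLp 2 (E₁ × E₂)) := disjointed (fun n ↦ C ∩ box ∩ 𝔑 n) with hB
  have hBm : ∀ n, MeasurableSet (B n) := fun n ↦
    MeasurableSet.disjointed (fun n ↦ (hCm.inter hboxm).inter (hSP n).2.2.1.measurableSet) n
  have hBd : Pairwise (Disjoint on B) := disjoint_disjointed _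
  have hBsub : ∀ n, B n ⊆ C ∩ box ∩ 𝔑 n := fun n ↦ disjointed_le (fun n ↦ C ∩ box ∩ 𝔑 n) n
  have hBU : (⋃ n, B n) = C ∩ box ∩ ⋃ n, 𝔑 n := by
    rw [hB, iUnion_disjointed, inter_iUnion]
  have hzero : ∀ z ∈ (C ∩ box) \ ⋃ n, B n, Ω (T.orientationFrame z) = 0 := by
    rintro z ⟨⟨hzC, hzbox⟩, hzU⟩
    obtain ⟨U, hU, hzU', g, hg, hAU, hsurj⟩ := hCreg z hzC
    have hcrit : ¬ ∀ v : E₂, ∃ u : WithLp 2 (E₁ × E₂), fderiv ℂ g z u = 0 ∧ (ofLp u).2 = v := by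
      intro h
      have hz0 : z ∈ C₀ := ⟨hzC, U, c₀, g, hU, hzU', hg, hAU, hsurj, h⟩
      exact hzU (hBU ▸ ⟨⟨hzC, hzbox⟩, hcov hz0⟩)
    have hgz : ∀ z' ∈ A ∩ U, g z' = 0 := fun z' hz' ↦ (hAU ▸ hz' : z' ∈ U ∩ g ⁻¹' {0}).2
    refine T.cross_apply_orientationFrame_eq_zero_of_critical h2 rfl hzC (hU.mem_nhds hzU')
      (hg.differentiableAt (hU.mem_nhds hzU')) (fun z' hz' ↦ ?_) hsurj (by omega) hcrit γ ν
    rw [hgz z' ⟨hCA hz'.1, hz'.2⟩, hgz z ⟨hCA hzC, hzU'⟩]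
  rw [setIntegral_eq_of_subset_of_forall_sdiff_eq_zero (hCm.inter hboxm) (hBU ▸ inter_subset_left) hzero,
    integral_iUnion hBm hBd (hint.mono_set (hBU ▸ inter_subset_left))]
  -- ### Step 4: the local coarea formula on each piece
  -- the parameter sets of the pieces
  set 𝔖 : ℕ → Set (WithLp 2 (EuclideanSpace ℂ (ULift.{u} (Fin q)) × E₂)) := fun n ↦ {w | w ∈ 𝔚 n ∧ 𝔰 n w ∈ B n}
    with h𝔖
  have h𝔖W : ∀ n, 𝔖 n ⊆ 𝔚 n := fun n w hw ↦ hw.1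
  have himg : ∀ n, 𝔰 n '' 𝔖 n = B n := fun n ↦ by
    apply Subset.antisymm
    · rintro _ ⟨w, hw, rfl⟩; exact hw.2
    · intro z hz
      obtain ⟨w, hw, rfl⟩ : z ∈ 𝔰 n '' 𝔚 n := hsWN n ▸ ⟨(hBsub n hz).1.1, (hBsub n hz).2⟩
      exact ⟨w, ⟨hw, hz⟩, rfl⟩
  have h𝔖m : ∀ n, MeasurableSet (𝔖 n) := fun n ↦ by
    have hmeas : Measurable ((𝔚 n).piecewise (𝔰 n) (fun _ ↦ (0 : WithLp 2 (E₁ × E₂)))) :=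
      ContinuousOn.measurable_piecewise (hSP n).2.2.2.1.continuousOn continuousOn_const
        (hSP n).2.1.measurableSet
    have : 𝔖 n = 𝔚 n ∩ (𝔚 n).piecewise (𝔰 n) (fun _ ↦ (0 : WithLp 2 (E₁ × E₂))) ⁻¹' B n := by
      ext w
      simp only [h𝔖, mem_setOf_eq, mem_inter_iff, mem_preimage]
      constructor
      · rintro ⟨hw, hB⟩; exact ⟨hw, by rwa [piecewise_eq_of_mem _ _ _ hw]⟩
      · rintro ⟨hw, hB⟩; exact ⟨hw, by rwa [piecewise_eq_of_mem _ _ _ hw] at hB⟩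
    rw [this]
    exact (hSP n).2.1.measurableSet.inter (hmeas (hBm n))
  set e' : OrthonormalBasis (Fin q) ℂ (EuclideanSpace ℂ (ULift.{u} (Fin q))) :=
    (EuclideanSpace.basisFun (ULift.{u} (Fin q)) ℂ).reindex Equiv.ulift with he'
  -- the fibre integrals of the pieces
  set Fn : ℕ → E₂ → ℂ := fun n t ↦ ∫ x in {x : EuclideanSpace ℂ (ULift.{u} (Fin q)) | toLp 2 (x, t) ∈ 𝔖 n},
      γ (fun i ↦ (ofLp (fderiv ℂ (𝔰 n) (toLp 2 (x, t)) (toLp 2 (complexFrame ⇑e' i, (0 : E₂))))).1)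
      ∂(μHE[2 * q] : Measure (EuclideanSpace ℂ (ULift.{u} (Fin q)))) with hFn
  have hintB : ∀ n, IntegrableOn (fun z ↦ (fun _ ↦ (1 : ℂ)) z * Ω (T.orientationFrame z)) (𝔰 n '' 𝔖 n)
      (μHE[2 * (q + (finrank ℂ E₂))] : Measure (WithLp 2 (E₁ × E₂))) := fun n ↦ by
    rw [himg n]
    simpa only [one_mul] using hint.mono_set ((hBsub n).trans inter_subset_left)
  have hpiece : ∀ n, ∫ z in B n, Ω (T.orientationFrame z) ∂(μHE[2 * (q + (finrank ℂ E₂))] : Measure (WithLp 2 (E₁ × E₂))) =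
      ν (complexFrame ⇑e₂) * ∫ t, Fn n t ∂(μHE[2 * (finrank ℂ E₂)] : Measure E₂) := fun n ↦ by
    have h := HolomorphicChain.integral_image_section_cross_eq hD T rfl h2 hK₀ rfl (𝔩 n) (hℓ₂ n)
      (hSP n).2.1 (hSP n).2.2.2.1 (hSP n).2.2.2.2.1 (hsW n) (hopen n) γ ν (fun _ ↦ (1 : ℂ)) e' e₂
      (h𝔖m n) (h𝔖W n) (hintB n)
    simp only [one_mul, himg n] at h
    rw [h]
  simp_rw [hpiece]
  rw [tsum_mul_left]
  -- the case `ν(e₂, ie₂, …) = 0` is degenerate: both sides vanish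
  by_cases hν : ν (complexFrame ⇑e₂) = 0
  · rw [hν, zero_mul, zero_mul]
  congr 1
  -- ### Step 5: interchange of sum and fibre integral
  have h𝔖' : ∀ n, MeasurableSet ((toLp 2 : EuclideanSpace ℂ (ULift.{u} (Fin q)) × E₂ →
      WithLp 2 (EuclideanSpace ℂ (ULift.{u} (Fin q)) × E₂)) ⁻¹' 𝔖 n) := fun n ↦
    (h𝔖m n).preimage (WithLp.measurable_toLp 2 _)
  have h𝔖t : ∀ n t, MeasurableSet {x : EuclideanSpace ℂ (ULift.{u} (Fin q)) | toLp 2 (x, t) ∈ 𝔖 n} := fun n t ↦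
    (h𝔖' n).preimage measurable_prodMk_right
  have hF_meas : ∀ n, AEStronglyMeasurable (Fn n) (μHE[2 * (finrank ℂ E₂)] : Measure E₂) := fun n ↦ by
    have hI := HolomorphicChain.integrableOn_preimage_toLp_cross_integrand hD T rfl h2 hK₀ rfl (𝔩 n)
      (hℓ₂ n) (hSP n).2.1 (hSP n).2.2.2.1 (hSP n).2.2.2.2.1 (hsW n) (hopen n) γ ν (fun _ ↦ (1 : ℂ)) e' e₂
      hν (h𝔖m n) (h𝔖W n) (hintB n)
    have hI' := ((integrable_indicator_iff (h𝔖' n)).2 hI).integral_prod_right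
    refine hI'.aestronglyMeasurable.congr (ae_of_all _ fun t ↦ ?_)
    simp only [hFn]
    rw [← integral_indicator (h𝔖t n t)]
    congr 1
    funext x
    simp only [indicator, mem_preimage, mem_setOf_eq, one_mul]
  have hF_sum : ∑' n, ∫⁻ t, ‖Fn n t‖ₑ ∂(μHE[2 * (finrank ℂ E₂)] : Measure E₂) ≠ ∞ := by
    have hνe : ‖ν (complexFrame ⇑e₂)‖ₑ ≠ 0 := by simpa using hν
    have hνt : ‖ν (complexFrame ⇑e₂)‖ₑ ≠ ⊤ := enorm_ne_top
    have hlin : ∀ n, ∫⁻ t, ∫⁻ x in {x : EuclideanSpace ℂ (ULift.{u} (Fin q)) | toLp 2 (x, t) ∈ 𝔖 n},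
        ‖γ (fun i ↦ (ofLp (fderiv ℂ (𝔰 n) (toLp 2 (x, t))
          (toLp 2 (complexFrame ⇑e' i, (0 : E₂))))).1)‖ₑ
          ∂(μHE[2 * q] : Measure (EuclideanSpace ℂ (ULift.{u} (Fin q)))) ∂(μHE[2 * (finrank ℂ E₂)] : Measure E₂) =
        ‖ν (complexFrame ⇑e₂)‖ₑ⁻¹ *
          ∫⁻ z in B n, ‖Ω (T.orientationFrame z)‖ₑ ∂(μHE[2 * (q + (finrank ℂ E₂))] : Measure (WithLp 2 (E₁ × E₂))) := by
      intro n
      have h := HolomorphicChain.lintegral_image_section_cross_eq_enorm hD T rfl h2 hK₀ rfl (𝔩 n) (hℓ₂ n)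
        (hSP n).2.1 (hSP n).2.2.2.1 (hSP n).2.2.2.2.1 (hsW n) (hopen n) γ ν (G := fun _ ↦ (1 : ℝ≥0∞))
        measurable_const e' e₂ (h𝔖m n) (h𝔖W n)
      simp only [one_mul, himg n] at h
      rw [h, ← mul_assoc, ENNReal.inv_mul_cancel hνe hνt, one_mul]
    have hle : ∀ n, ∫⁻ t, ‖Fn n t‖ₑ ∂(μHE[2 * (finrank ℂ E₂)] : Measure E₂) ≤ ‖ν (complexFrame ⇑e₂)‖ₑ⁻¹ *
        ∫⁻ z in B n, ‖Ω (T.orientationFrame z)‖ₑ ∂(μHE[2 * (q + (finrank ℂ E₂))] : Measure (WithLp 2 (E₁ × E₂))) :=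
      fun n ↦ by
      rw [← hlin n]
      exact lintegral_mono fun t ↦ enorm_integral_le_lintegral_enorm _
    refine ne_top_of_le_ne_top ?_ (ENNReal.tsum_le_tsum hle)
    rw [ENNReal.tsum_mul_left, ← lintegral_iUnion hBm hBd]
    refine ENNReal.mul_ne_top (ENNReal.inv_ne_top.2 hνe) ?_
    exact (lt_of_le_of_lt (lintegral_mono_set (hBU ▸ inter_subset_left)) hint.2).ne
  rw [← integral_tsum hF_meas hF_sum]
  -- ### Step 6: identification of the fibre integrals, for a.e. `t`
  have hfib : ∀ᵐ t ∂(μHE[2 * (finrank ℂ E₂)] : Measure E₂), ∑' n, Fn n t = (periodBox Φ₂ 0).indicator F t := by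
    filter_upwards [ae_hasPureDim_fibreSlice Φ₁ Φ₂ (μHE[2 * (finrank ℂ E₂)] : Measure E₂) hZ] with t ht
    obtain ⟨ht1, ht2, ht3⟩ := ht
    -- the parameter points of the pieces over `t`
    have hSt : ∀ n (x : EuclideanSpace ℂ (ULift.{u} (Fin q))), toLp 2 (x, t) ∈ 𝔖 n →
        𝔰 n (toLp 2 (x, t)) ∈ C ∩ box ∧ (ofLp (𝔰 n (toLp 2 (x, t)))).2 = t := fun n x hx ↦
      ⟨(hBsub n hx.2).1, hs2 n _ hx.1⟩
    have hsxt : ∀ n (x : EuclideanSpace ℂ (ULift.{u} (Fin q))), toLp 2 (x, t) ∈ 𝔚 n →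
        𝔰 n (toLp 2 (x, t)) = toLp 2 ((ofLp (𝔰 n (toLp 2 (x, t)))).1, t) := fun n x hx ↦ by
      have h' : ofLp (𝔰 n (toLp 2 (x, t))) = ((ofLp (𝔰 n (toLp 2 (x, t)))).1, t) :=
        Prod.ext rfl (hs2 n _ hx)
      calc 𝔰 n (toLp 2 (x, t)) = toLp 2 (ofLp (𝔰 n (toLp 2 (x, t)))) := rfl
        _ = toLp 2 ((ofLp (𝔰 n (toLp 2 (x, t)))).1, t) := by rw [h']
    -- if all the pieces are empty over `t`, the sum vanishes
    have hempty : (∀ n, {x : EuclideanSpace ℂ (ULift.{u} (Fin q)) | toLp 2 (x, t) ∈ 𝔖 n} = ∅) →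
        ∑' n, Fn n t = 0 := fun h ↦ by
      have h0 : ∀ n, Fn n t = 0 := fun n ↦ by
        simp only [hFn, h n, Measure.restrict_empty, integral_zero_measure]
      simp [h0]
    by_cases htbox : t ∈ periodBox Φ₂ 0
    swap
    · rw [indicator_of_notMem htbox]
      apply hempty
      intro n
      apply eq_empty_of_forall_notMem
      intro x hx
      have h := hSt n x hx
      exact htbox (h.2 ▸ ((hmembox _).1 h.1.2).2)
    rw [indicator_of_mem htbox]
    rcases ht3 with hZt0 | hZt
    · -- empty slice: no piece meets the fibre
      have hF0 : F t = 0 := by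
        simp only [hF]
        rw [dif_neg]
        intro h
        exact h.nonempty.ne_empty hZt0
      rw [hF0]
      apply hempty
      intro n
      apply eq_empty_of_forall_notMem
      intro x hx
      have h := hSt n x hx
      have hxA : (ofLp (𝔰 n (toLp 2 (x, t)))).1 ∈ {y : E₁ | toLp 2 (y, t) ∈ A} := by
        show toLp 2 ((ofLp (𝔰 n (toLp 2 (x, t)))).1, t) ∈ A
        rw [← hsxt n x hx.1]
        exact hCA h.1.1
      rw [setOf_toLp_mem_preimage_cover Φ₁ Φ₂ Z t, hZt0] at hxA
      exact hxA
    -- the generic case: the slice has pure dimension `q`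
    have hFt : F t = analyticCyclePeriod Φ₁ hZt γ := by
      simp only [hF]
      rw [dif_pos hZt]
    rw [hFt]
    set Tt := analyticChain Φ₁ hZt with hTt
    have hAt : {x : E₁ | toLp 2 (x, t) ∈ A} =
        cover Φ₁ ⁻¹' {x | (prodHomeomorphL2 Φ₁ Φ₂).symm (x, cover Φ₂ t) ∈ Z} :=
      setOf_toLp_mem_preimage_cover Φ₁ Φ₂ Z t
    have hmemCt : ∀ x, x ∈ Tt.carrier ↔
        toLp 2 (x, t) ∈ A ∧ ∃ c, SCV.IsRegPt {y : E₁ | toLp 2 (y, t) ∈ A} c x := by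
      intro x
      rw [mem_carrier_analyticChain_iff_isRegPt Φ₁ hZt, ← hAt]
      rfl
    -- over `t`, every regular point of `π⁻¹Z` is non-critical, hence slices to a regular point
    have hNC : ∀ x : E₁, toLp 2 (x, t) ∈ C → ∃ (U : Set (WithLp 2 (E₁ × E₂))) (c : ℕ)
        (g : WithLp 2 (E₁ × E₂) → (Fin c → ℂ)),
        IsOpen U ∧ toLp 2 (x, t) ∈ U ∧ DifferentiableOn ℂ g U ∧ A ∩ U = U ∩ g ⁻¹' {0} ∧
        Surjective (fderiv ℂ g (toLp 2 (x, t))) ∧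
        ∀ v : E₂, ∃ u : WithLp 2 (E₁ × E₂), fderiv ℂ g (toLp 2 (x, t)) u = 0 ∧ (ofLp u).2 = v := by
      intro x hxC
      by_contra hn
      exact ht1 ⟨toLp 2 (x, t), ⟨hCA hxC, ⟨c₀, hCreg _ hxC⟩, hn⟩, rfl⟩
    have hsliceC : ∀ x : E₁, toLp 2 (x, t) ∈ C → x ∈ Tt.carrier := by
      intro x hxC
      obtain ⟨U, c, g, hU, hzU, hg, hAU, hsurj, hnc⟩ := hNC x hxC
      obtain ⟨U', hU', hzU', g', hg', hAU', hsurj'⟩ := hCreg _ hxC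
      exact (hmemCt x).2 ⟨hCA hxC, c₀, isRegPt_slice_of_nonCritical (hCA hxC) hU hzU hg hAU hsurj hnc
        hU' hzU' hg' hAU' hsurj'⟩
    -- the slices of the pieces, their union, and the carrier of the slice chain
    have hBt_m : ∀ n, MeasurableSet {x : E₁ | toLp 2 (x, t) ∈ B n} := fun n ↦
      (hBm n).preimage ((WithLp.measurable_toLp 2 _).comp measurable_prodMk_right)
    have hBt_d : Pairwise (Disjoint on fun n ↦ {x : E₁ | toLp 2 (x, t) ∈ B n}) := fun i j hij ↦
      (hBd hij).preimage _
    set Ut : Set E₁ := ⋃ n, {x : E₁ | toLp 2 (x, t) ∈ B n} with hUt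
    set Vt : Set E₁ := Tt.carrier ∩ periodBox Φ₁ 0 with hVt
    have hUV : Ut ⊆ Vt := by
      intro x hx
      obtain ⟨n, hn⟩ := mem_iUnion.1 hx
      have h := hBsub n hn
      exact ⟨hsliceC x h.1.1, ((hmembox _).1 h.1.2).1⟩
    have hVU : Vt \ Ut ⊆ {x : E₁ | toLp 2 (x, t) ∈ singularLocus 𝓘(ℂ, WithLp 2 (E₁ × E₂)) A} := by
      rintro x ⟨⟨hxCt, hxbox⟩, hxU⟩
      have hxA : toLp 2 (x, t) ∈ A := ((hmemCt x).1 hxCt).1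
      refine ⟨hxA, fun hreg ↦ hxU ?_⟩
      have hzC : toLp 2 (x, t) ∈ C := by rw [hCeq]; exact hreg
      have hz0 : toLp 2 (x, t) ∈ C₀ := ⟨hzC, hNC x hzC⟩
      have hzbox : toLp 2 (x, t) ∈ box := (hmembox _).2 ⟨hxbox, htbox⟩
      have hzB : toLp 2 (x, t) ∈ ⋃ n, B n := hBU ▸ ⟨⟨hzC, hzbox⟩, hcov hz0⟩
      obtain ⟨n, hn⟩ := mem_iUnion.1 hzB
      exact mem_iUnion.2 ⟨n, hn⟩
    have ht2' : μH[((2 * q : ℕ) : ℝ)]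
        {x : E₁ | toLp 2 (x, t) ∈ singularLocus 𝓘(ℂ, WithLp 2 (E₁ × E₂)) A} = 0 := ht2
    have hnull : (μHE[2 * q] : Measure E₁) (Vt \ Ut) = 0 :=
      measure_mono_null hVU (by
        rw [Measure.euclideanHausdorffMeasure_def, Measure.smul_apply, ht2', smul_zero])
    have hUVae : Ut =ᵐ[(μHE[2 * q] : Measure E₁)] Vt := by
      refine ae_eq_set.2 ⟨?_, hnull⟩
      rw [sdiff_eq_empty.2 hUV, measure_empty]
    have hintt : IntegrableOn (fun x ↦ γ (Tt.orientationFrame x)) Vt (μHE[2 * q] : Measure E₁) :=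
      integrableOn_apply_orientationFrame_carrier_inter_periodBox Φ₁ hZt γ
    -- each fibre integral is the integral of `γ(ξ_{[Z_t]})` over the slice of the piece
    have hFn : ∀ n, Fn n t = ∫ x in {x : E₁ | toLp 2 (x, t) ∈ B n}, γ (Tt.orientationFrame x)
        ∂(μHE[2 * q] : Measure E₁) := by
      intro n
      have hWt : IsOpen {x : EuclideanSpace ℂ (ULift.{u} (Fin q)) | toLp 2 (x, t) ∈ 𝔚 n} :=
        (hSP n).2.1.preimage ((WithLp.prod_continuous_toLp 2 (EuclideanSpace ℂ (ULift.{u} (Fin q))) E₂).comp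
          (continuous_id.prodMk continuous_const))
      obtain ⟨hst, hDst⟩ := HolomorphicChain.differentiableOn_slice_section (hSP n).2.1 (hSP n).2.2.2.1 t
      have hℓst : ∀ x ∈ {x : EuclideanSpace ℂ (ULift.{u} (Fin q)) | toLp 2 (x, t) ∈ 𝔚 n},
          𝔩₁ n ((ofLp (𝔰 n (toLp 2 (x, t)))).1) = x := fun x hx ↦ by
        have h := (hSP n).2.2.2.2.1 _ hx
        rw [(hSP n).1] at h
        have h1 := congrArg (fun w ↦ (ofLp w).1) h
        simpa using h1
      have hstW : (fun x' : EuclideanSpace ℂ (ULift.{u} (Fin q)) ↦ (ofLp (𝔰 n (toLp 2 (x', t)))).1) ''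
          {x | toLp 2 (x, t) ∈ 𝔚 n} ⊆ Tt.carrier := by
        rintro _ ⟨x, hx, rfl⟩
        apply hsliceC
        rw [← hsxt n x hx]
        exact hsW n (mem_image_of_mem _ hx)
      have hopent : ∀ x ∈ {x : EuclideanSpace ℂ (ULift.{u} (Fin q)) | toLp 2 (x, t) ∈ 𝔚 n},
          ∃ N ∈ 𝓝 ((ofLp (𝔰 n (toLp 2 (x, t)))).1), Tt.carrier ∩ N ⊆
            (fun x' : EuclideanSpace ℂ (ULift.{u} (Fin q)) ↦ (ofLp (𝔰 n (toLp 2 (x', t)))).1) ''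
              {x | toLp 2 (x, t) ∈ 𝔚 n} := by
        intro x hx
        refine ⟨{y : E₁ | toLp 2 (y, t) ∈ 𝔑 n}, ((hSP n).2.2.1.preimage
          ((WithLp.prod_continuous_toLp 2 E₁ E₂).comp (continuous_id.prodMk continuous_const))).mem_nhds ?_,
          ?_⟩
        · show toLp 2 ((ofLp (𝔰 n (toLp 2 (x, t)))).1, t) ∈ 𝔑 n
          rw [← hsxt n x hx]
          exact ((hsWN n).le (mem_image_of_mem _ hx)).2
        · rintro y ⟨hyC, hyN⟩
          have hyA : toLp 2 (y, t) ∈ A := ((hmemCt y).1 hyC).1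
          have hy : toLp 2 (y, t) ∈ 𝔰 n '' 𝔚 n := by
            rw [(hSP n).2.2.2.2.2.1]; exact ⟨hyA, hyN⟩
          have heq := HolomorphicChain.slice_image_section_eq (𝔩 n) (hℓ₂ n) (hSP n).2.2.2.2.1
            (S := 𝔚 n) Subset.rfl t
          show y ∈ (fun x' : EuclideanSpace ℂ (ULift.{u} (Fin q)) ↦ (ofLp (𝔰 n (toLp 2 (x', t)))).1) ''
              {x | toLp 2 (x, t) ∈ 𝔚 n}
          rw [← heq]
          exact hy
      have key := HolomorphicChain.integral_image_section_eq hq Tt hK₀ (𝔩₁ n) hWt hst hℓst hstW hopent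
        e'.orthonormal (fun _ ↦ γ) (fun _ ↦ (1 : ℂ)) (h𝔖t n t) (fun x hx ↦ h𝔖W n hx)
      simp only [one_mul] at key
      rw [← himg n, HolomorphicChain.slice_image_section_eq (𝔩 n) (hℓ₂ n) (hSP n).2.2.2.2.1 (h𝔖W n) t,
        key]
      simp only [hFn]
      refine setIntegral_congr_fun (h𝔖t n t) fun x hx ↦ ?_
      congr 1
      funext i
      exact (hDst x (h𝔖W n hx) _).symm
    calc ∑' n, Fn n t
        = ∑' n, ∫ x in {x : E₁ | toLp 2 (x, t) ∈ B n}, γ (Tt.orientationFrame x)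
            ∂(μHE[2 * q] : Measure E₁) := tsum_congr hFn
      _ = ∫ x in Ut, γ (Tt.orientationFrame x) ∂(μHE[2 * q] : Measure E₁) :=
          (integral_iUnion hBt_m hBt_d (hintt.mono_set hUV)).symm
      _ = ∫ x in Vt, γ (Tt.orientationFrame x) ∂(μHE[2 * q] : Measure E₁) := setIntegral_congr_set hUVae
      _ = analyticCyclePeriod Φ₁ hZt γ := (analyticCyclePeriod_eq_setIntegral Φ₁ hZt γ).symm
  rw [integral_congr_ae hfib, integral_indicator (measurableSet_periodBox Φ₂ 0)]

end Fibre

end ComplexTorus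

end Literature.Geometry.Kaehler

end
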